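import Summits.QuantumFields.BalabanUV.Beta.GAN24.Lin4Additive
import Summits.QuantumFields.BalabanUV.Beta.GAN24.WSlotT2OfPieces
import Summits.QuantumFields.BalabanUV.Beta.SecondOrderRemainderTables
import Summits.QuantumFields.BalabanUV.Beta.TameKernelCalculus
import Summits.QuantumFields.BalabanUV.Beta.KernelWardRelative
import Summits.QuantumFields.BalabanUV.Gaps.CapTailPinnedLimitSign
import Literature.MathematicalPhysics.QuantumFieldTheory.Balaban1983to89.Beta.StepDriftWitness

/-!
# `BalabanUV.Gaps.D1PinnedColourFreeCore` — cell pub-balaban-gaps, row (D1), seat g1-p1: THE COLOUR-FREE CORE OF THE PINNED FAMILY — at `(cE, cVH, cΛ) = 0⃗` an2's first-order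
# tables VANISH, the step kernels are PURE TADPOLES (no bubble), the third-order read-out is the bare sandwich `−K·W·K` and an2's recursive bi-stencil family is the LINEAR
# TOWER `T_{j+1} = −cE₂·wV4 • mmRead (K_j ∘ W_j ∘ K_j) + cB·wB2 • border`, `W_j = W2SymOfK K_j 0 0 T_j (M2Of j)` — the system in which, by the sibling files, the three
# universal pieces `γ(r)`, `σ(r)`, `λ(Tc)` of `lim β⁰ = γ(r) + φ(c⃗) + cB·σ(r) + λ(Tc)` live

HONEST FRAMING (cell rule, page 1 of everything): [folklore] unfolding of an2's DEFINITIONS (`BalabanStepJets.S0`, `BalabanStepJetsSucc.Sstep ∕ JsBal0Of`, `BalabanStepW2.Spure ∕ M1 ∕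
e4OfW ∕ K3OfK ∕ T2Of`, `SecondOrderResponse.dM ∕ K2OfK`) at zero first-order colour constants, an5's ∕ the β sub-cell's zero lemmas (`StepDriftWitness.comp_zero_right ∕
bubble_zero ∕ vertexOfK_zeroStencil`, `KernelWardRelative.comp_zero_left`), an1's closed form `MixedJetTablesPlug.TbalOf_JsBalAn1`; NOTHING of Bałaban's asserted; NO value of
`γ, σ, λ` computed or signed; which colour data are print's NOT decided ((P6)); (D1) NOT discharged; 0∕4 row-D1 binders; NOT `BetaPertH`, NOT the continuum limit, NOT Clay.
HONEST DEPENDENCY (b2b cell, verbatim): «continuum YM on T⁴ ⇐ BetaPertH ∧ nine spine estimates (0/9 proved); BetaPertH ⇐ (D1) ∧ (D4) ∧ CAP+tail; G-an2-4 gates asym, D1 and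
NE2/3/4.»

WHY (row (D1); census row 70 (b) of `HOME/g1/RESIDUE.md` — the row's compute target made kernel-precise).  By this seat's GEN 10 files the pinned family's limit coefficient is
`γ(r) + φ(c⃗) + cB·σ(r) + λ(Tc)` and `γ(r) = lim β⁰(r,0⃗;0,0)`, `σ(r) = lim β⁰(r,0⃗;1,0) − lim β⁰(r,0⃗;0,0)`, `λ(Tc) = lim β⁰(r,0⃗;0,Tc) − lim β⁰(r,0⃗;0,0)` are read at the
member with ZERO first-order colour constants.  THIS FILE records what that member IS, by unfolding an2's definitions: §1 its first-order stencil families are identically zero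
(`S0_colourZero`, `Sstep_colourZero`, `Spure_colourZero`, `M1_colourZero`), so the axial vertex family vanishes (`axVertexOfK_zeroFamily`) and **the step kernel is the pure
tadpole** `TbalOf Lc (JsBalAn1 r 0⃗ cE₂ cB T) j μ ν z = ½·tadpole (axDressK Lc (KInvStep Lc j)) (W_j μ 0 ν z)` (§2, **`TbalOf_JsBalAn1_colourZero`**); §3 the operator
derivatives `dM`, `K2OfK` vanish, the third-order read-out is the bare sandwich (**`K3OfK_zeroTables`**, **`e4OfW_colourZero`**) and the recursion is the LINEAR TOWER
**`T2Of_colourZero_succ`**; §4 the (1.22) coefficient of that member is the second moment of the pure tadpole (**`secondMoment_JsBalAn1_colourZero`**), and at the pin its limit is the limit of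
those pure-tadpole second moments (**`lim_JsBalAn1_colourZero`**).  READING: the three
universal pieces are second moments of PURE TADPOLES of a LINEAR tower driven by an1's two rooted tables and an3's Wilson table through an4's `KInvStep` alone — the
smallest honest system a compute desk has to evaluate to decide the trichotomy of the capstone (census row 69b∕70); nothing is evaluated here.

ABSOLUTE RULE (cell charter, verbatim): «No internally-minted statement may enter as a cited fact. Every hypothesis is either kernel-proved in this
package or a verbatim quotation of a PUBLISHED theorem with page reference. The manuscript(s) under audit are NOT citable for their own disputed
steps — they are the thing under adjudication; programme-internal (2001/route/tribunal) claims are never citable.»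

Provenance: cell pub-balaban-gaps, seat g1-p1 GEN 10 (prover-pub-balaban-gaps-g1-p1-g10-0), 2026-08-23; imports built modules only; independent of the sibling files; no existing
file touched.
-/

noncomputable section

open Literature.MathematicalPhysics.QuantumFieldTheory Balaban1983to89 Balaban1983to89.Beta Filter Topology
open ExpKernelCalculus (MKer Decays BiLoc VertexFamily₂ comp hessKer tadpole bubble)
open OneStepResolventKernel (Fib wsum)
open OneStepKernelFamily (KInvStep TbalOf vertexOfK)
open SecondOrderResponse (W2SymOfK LocStencilFM dM K2OfK vertexOfM)
open BalabanCompositeJets (LocStencil₂)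
open BalabanStepJets (S0)
open BalabanStepJetsSucc (mmRead JsBal0Of Sstep)
open BalabanStepW2 (Spure M1 M2Of WbalOf T2Of T2Of_zero T2Of_succ e4OfW K3OfK wV4 wB2 WbalT2Of)
open StepJetData (mfNeg)
open AffineAveraging (box toSite)
open AveragingMixedJetTables (vh₂SAt mixFFAt)
open RateCertificate (CauchyRate)
open AxialDressing (axDressK axVertexOfK)
open StepDriftWitness (comp_zero_right bubble_zero)
open Summit.QuantumFields.BalabanUV.Beta.KernelWardRelative (comp_zero_left)
open Summit.QuantumFields.BalabanUV.Beta.MixedJetTablesPlug (JsBalAn1 TbalOf_JsBalAn1)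
open Summit.QuantumFields.BalabanUV.Beta.GAN24.StencilSlotOfE3 (one_le_of_two_le)

namespace Summit.QuantumFields.BalabanUV.Gaps.D1PinnedColourFreeCore

variable {d : ℕ} {Lc : ℕ} [NeZero Lc]

/-! ## §1 At zero first-order colour constants an2's first-order tables vanish -/

/-- [folklore] `S₀` at `cE = cVH = cΛ = 0` is the zero stencil family (every summand carries the factor `0`). -/
theorem S0_colourZero : S0 d Lc 0 0 0 = fun _ _ => 0 := by
  funext κ u x z a b
  simp [BalabanStepJets.S0]

/-- [folklore] `S_j` at `cE = cVH = cΛ = 0` is the zero stencil family. -/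
theorem Sstep_colourZero (j : ℕ) : Sstep d Lc 0 0 0 j = fun _ _ => 0 := by
  funext κ u x z a b
  simp [BalabanStepJetsSucc.Sstep]

/-- [folklore] an2's unfolded first field stencil at zero colour constants is zero, every level. -/
theorem Spure_colourZero : ∀ j : ℕ, Spure d Lc 0 0 0 j = fun _ _ => 0
  | 0 => by funext κ u x z a b; simp [BalabanStepW2.Spure]
  | j + 1 => by funext κ u x z a b; simp [BalabanStepW2.Spure]

omit [NeZero Lc] in
/-- [folklore] an2's first multiplier table at `cΛ = 0` is zero. -/
theorem M1_colourZero (j : ℕ) : M1 d Lc 0 j = fun _ _ => 0 := by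
  funext ρ w x z a b
  simp [BalabanStepW2.M1]

/-- [folklore] The stencil of an2's jet datum at zero colour constants is the zero family, every level. -/
theorem JsBal0Of_S_colourZero (hLc : 1 ≤ Lc)
    (W : ℕ → Fin (d + 1) → (Fin (d + 1) → ℤ) → Fin (d + 1) → (Fin (d + 1) → ℤ) → MKer (d + 1) (Fib d)) (Cw δw : ℕ → ℝ) (hδw : ∀ j, 0 < δw j) (hW : ∀ j, VertexFamily₂ (W j) Lc (Cw j) (δw j)) :
    ∀ j : ℕ, (JsBal0Of hLc 0 0 0 W Cw δw hδw hW j).S = fun _ _ => 0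
  | 0 => by show S0 d Lc 0 0 0 = _; exact S0_colourZero
  | j + 1 => by show Sstep d Lc 0 0 0 (j + 1) = _; exact Sstep_colourZero (j + 1)

/-- [folklore] A weighted superposition of zero kernels is zero. -/
theorem wsum_zeroFamily {D : ℕ} {F : Type*} (w : (Fin D → ℤ) → ℝ) : wsum w (fun _ => (0 : MKer D F)) = 0 := by
  funext x z a b
  simp [OneStepResolventKernel.wsum]

/-- [folklore] The axially dressed vertex family of the zero stencil family vanishes. -/
theorem axVertexOfK_zeroFamily (K : MKer (d + 1) (Fib d)) (N : ℕ) : axVertexOfK K N (fun _ _ => 0) = fun _ _ => 0 := by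
  funext μ y x z a b
  simp [AxialDressing.axVertexOfK, OneStepResolventKernel.wsum]

/-! ## §2 The step kernel at zero colour constants is the pure tadpole -/

/-- [folklore] `hessKer` with the zero bubble family is the pure tadpole `½·tadpole A (W μ 0 ν z)` (`StepDriftWitness.bubble_zero`). -/
theorem hessKer_zeroVertex {D : ℕ} {F : Type*} [Fintype F] (A : MKer D F) (W : Fin D → (Fin D → ℤ) → Fin D → (Fin D → ℤ) → MKer D F)
    (μ ν : Fin D) (z : Fin D → ℤ) :
    hessKer A (fun _ _ => 0) W μ ν z = (1 / 2) * tadpole A (W μ 0 ν z) := by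
  simp [ExpKernelCalculus.hessKer, bubble_zero]

section Pinned

variable {r : Fin (3 + 1) → ℕ}

/-- [folklore] **THE COLOUR-FREE MEMBER's STEP KERNEL IS THE PURE TADPOLE** (any `cE₂ cB T`, any box root, every level, every entry):
`TbalOf Lc (JsBalAn1 r 0 0 0 cE₂ cB T) j μ ν z = ½ · tadpole (axDressK Lc (KInvStep Lc j)) (WbalT2Of 0 0 0 cE₂ cB T … j μ 0 ν z)` — an1's closed form, §1
(`JsBal0Of_S_colourZero`, `axVertexOfK_zeroFamily`) and `hessKer_zeroVertex`.  No bubble: the colour-free pieces `γ(r), σ(r), λ(Tc)` of the sibling files are tadpole quantities. -/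
theorem TbalOf_JsBalAn1_colourZero (hLc : 1 ≤ Lc) (hr : r ∈ box (3 + 1) Lc) (cE₂ cB : ℝ) (T : Fin 4 → Fin 4 → Fin 4 → Fin 4 → ℝ)
    (j : ℕ) (μ ν : Fin 4) (z : Fin 4 → ℤ) :
    TbalOf Lc (JsBalAn1 hLc hr 0 0 0 cE₂ cB T) j μ ν z =
      (1 / 2) * tadpole (axDressK Lc (KInvStep (d := 3) Lc j))
        (WbalT2Of (Lc := Lc) 0 0 0 cE₂ cB T (vh₂S := vh₂SAt (toSite r) Lc) (mixFF := mixFFAt (toSite r) Lc) j μ 0 ν z) := by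
  rw [TbalOf_JsBalAn1 hLc hr 0 0 0 cE₂ cB T j, JsBal0Of_S_colourZero hLc _ _ _ _ _ j, axVertexOfK_zeroFamily, hessKer_zeroVertex]

/-- [folklore] **THE COLOUR-FREE MEMBER's (1.22) COEFFICIENT IS THE SECOND MOMENT OF THE PURE TADPOLE** (every level, every channel). -/
theorem secondMoment_JsBalAn1_colourZero (hLc : 1 ≤ Lc) (hr : r ∈ box (3 + 1) Lc) (cE₂ cB : ℝ) (T : Fin 4 → Fin 4 → Fin 4 → Fin 4 → ℝ)
    (j : ℕ) (μ ν : Fin 4) :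
    B12Beta.secondMoment (TbalOf Lc (JsBalAn1 hLc hr 0 0 0 cE₂ cB T) j) μ ν =
      B12Beta.secondMoment (fun μ' ν' z => (1 / 2) * tadpole (axDressK Lc (KInvStep (d := 3) Lc j))
        (WbalT2Of (Lc := Lc) 0 0 0 cE₂ cB T (vh₂S := vh₂SAt (toSite r) Lc) (mixFF := mixFFAt (toSite r) Lc) j μ' 0 ν' z)) μ ν := by
  have h : TbalOf Lc (JsBalAn1 hLc hr 0 0 0 cE₂ cB T) j = fun μ' ν' z => (1 / 2) * tadpole (axDressK Lc (KInvStep (d := 3) Lc j))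
      (WbalT2Of (Lc := Lc) 0 0 0 cE₂ cB T (vh₂S := vh₂SAt (toSite r) Lc) (mixFF := mixFFAt (toSite r) Lc) j μ' 0 ν' z) := by
    funext μ' ν' z; exact TbalOf_JsBalAn1_colourZero hLc hr cE₂ cB T j μ' ν' z
  rw [h]

end Pinned

/-! ## §3 At zero first-order tables the third-order read-out is the bare sandwich and an2's recursion is a LINEAR tower -/

/-- [folklore] The multiplier-column vertex of the zero table vanishes. -/
theorem vertexOfM_zeroFamily (K : MKer (d + 1) (Fib d)) (N : ℕ) : vertexOfM K N (fun _ _ => 0) = fun _ _ => 0 := by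
  funext μ y x z a b
  simp [SecondOrderResponse.vertexOfM, InterLevelTransport.cwsum, InterLevelTransport.onLat, OneStepResolventKernel.wsum]

/-- [folklore] The field-column vertex of the zero stencil family vanishes (cf. `StepDriftWitness.vertexOfK_zeroStencil`). -/
theorem vertexOfK_zeroFamily (K : MKer (d + 1) (Fib d)) (N : ℕ) : vertexOfK K N (fun _ _ => 0) = fun _ _ => 0 := by
  funext μ y x z a b
  simp [OneStepKernelFamily.vertexOfK, OneStepResolventKernel.wsum]

/-- [folklore] The operator derivative along zero first-order tables vanishes: `dM K N 0 0 = 0`. -/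
theorem dM_zeroTables (K : MKer (d + 1) (Fib d)) (N : ℕ) : dM K N (fun _ _ => 0) (fun _ _ => 0) = fun _ _ => 0 := by
  funext μ y
  show vertexOfK K N (fun _ _ => 0) μ y + vertexOfM K N (fun _ _ => 0) μ y = 0
  rw [vertexOfK_zeroFamily, vertexOfM_zeroFamily]
  exact add_zero 0

/-- [folklore] The derivative of the inverse along zero first-order tables vanishes: `K2OfK K N 0 0 = 0`. -/
theorem K2OfK_zeroTables (K : MKer (d + 1) (Fib d)) (N : ℕ) : K2OfK K N (fun _ _ => 0) (fun _ _ => 0) = fun _ _ => 0 := by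
  funext ν y' x z a b
  unfold SecondOrderResponse.K2OfK
  rw [dM_zeroTables]
  simp [comp_zero_right, comp_zero_left]

/-- [folklore] **AT ZERO FIRST-ORDER TABLES THE THIRD-ORDER READ-OUT IS THE BARE SANDWICH**: `K3OfK K N 0 0 W b = −K ∘ W b ∘ K`. -/
theorem K3OfK_zeroTables (K : MKer (d + 1) (Fib d)) (N : ℕ) (W : Fin (d + 1) → (Fin (d + 1) → ℤ) → Fin (d + 1) → (Fin (d + 1) → ℤ) → MKer (d + 1) (Fib d))
    (μ : Fin (d + 1)) (y : Fin (d + 1) → ℤ) (ν : Fin (d + 1)) (y' : Fin (d + 1) → ℤ) :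
    K3OfK K N (fun _ _ => 0) (fun _ _ => 0) W μ y ν y' = -comp (comp K (W μ y ν y')) K := by
  funext x z a b
  unfold BalabanStepW2.K3OfK
  rw [K2OfK_zeroTables, dM_zeroTables]
  simp [comp_zero_right]

/-- [folklore] **THE VALUE-4-JET READ-OUT AT ZERO COLOUR CONSTANTS IS `−mmRead (K_j ∘ W ∘ K_j)`** (`Spure_colourZero`, `M1_colourZero`, `K3OfK_zeroTables`). -/
theorem e4OfW_colourZero (j : ℕ) (W : Fin (d + 1) → (Fin (d + 1) → ℤ) → Fin (d + 1) → (Fin (d + 1) → ℤ) → MKer (d + 1) (Fib d))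
    (μ : Fin (d + 1)) (y : Fin (d + 1) → ℤ) (ν : Fin (d + 1)) (y' : Fin (d + 1) → ℤ) :
    e4OfW d Lc j (Spure d Lc 0 0 0 j) (M1 d Lc 0 j) W μ y ν y' =
      -mmRead Lc (comp (comp (KInvStep (d := d) Lc j) (W μ y ν y')) (KInvStep (d := d) Lc j)) := by
  unfold BalabanStepW2.e4OfW
  rw [Spure_colourZero, M1_colourZero, K3OfK_zeroTables]
  funext x z a b
  rcases a with α | m <;> rcases b with β | m' <;> simp [BalabanStepJetsSucc.mmRead]

/-- [folklore] **an2's RECURSIVE FAMILY AT ZERO COLOUR CONSTANTS IS A LINEAR TOWER**: member `j+1` is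
`−(cE₂·wV4 (j+1)) • mmRead (K_j ∘ W_j b ∘ K_j) + (cB·wB2 (j+1)) • mfNeg ∘ B` with `W_j = W2SymOfK K_j Lc 0 0 (T2Of … j) (M2Of mixFF j)` — LINEAR in the previous
member, in an1's mixed table and in the border, with an4's `KInvStep` as the only kernel (`T2Of_succ` + `e4OfW_colourZero`). -/
theorem T2Of_colourZero_succ (cE₂ cB : ℝ) (T : Fin 4 → Fin 4 → Fin 4 → Fin 4 → ℝ) (B mixFF : Fin (d + 1) → (Fin (d + 1) → ℤ) → Fin (d + 1) → (Fin (d + 1) → ℤ) → MKer (d + 1) (Fib d)) (j : ℕ)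
    (κ : Fin (d + 1)) (u : Fin (d + 1) → ℤ) (κ' : Fin (d + 1)) (u' : Fin (d + 1) → ℤ) :
    T2Of d Lc 0 0 0 cE₂ cB T B mixFF (j + 1) κ u κ' u' =
      -((cE₂ * wV4 d Lc (j + 1)) • mmRead Lc (comp (comp (KInvStep (d := d) Lc j)
          (W2SymOfK (KInvStep (d := d) Lc j) Lc (fun _ _ => 0) (fun _ _ => 0) (T2Of d Lc 0 0 0 cE₂ cB T B mixFF j) (M2Of d Lc mixFF j) κ u κ' u'))
          (KInvStep (d := d) Lc j))) +
        (cB * wB2 d Lc (j + 1)) • mfNeg (B κ u κ' u') := by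
  rw [T2Of_succ]
  simp only
  rw [e4OfW_colourZero]
  unfold BalabanStepW2.WbalOf
  rw [Spure_colourZero, M1_colourZero, smul_neg]

/-! ## §4 At the pin: the colour-free limit coefficient is the limit of pure-tadpole second moments of the linear tower -/

section PinnedLimit

variable {r : Fin (3 + 1) → ℕ}

/-- [folklore] **THE COLOUR-FREE LIMIT COEFFICIENT OF THE PINNED FAMILY** (`2 ≤ Lc`, the pin `cE₂ := Lc^8`, any root, any `cB`, `Tc`, any channel):
`lim β⁰(r,0⃗;cB,Tc) = lim_j secondMoment (½·tadpole (axDressK Lc (KInvStep Lc j)) (W_j · 0 · ·))`, `W_j = WbalT2Of 0 0 0 (Lc^8) cB Tc … j` the assembled family of the LINEAR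
tower of §3 at an1's rooted tables — by the sibling files `= γ(r) + cB·σ(r) + λ(Tc)`: the three universal pieces are limits of PURE-TADPOLE second moments
(`secondMoment_JsBalAn1_colourZero` under `CauchyRate.lim`). -/
theorem lim_JsBalAn1_colourZero (hLc : 2 ≤ Lc) (hr : r ∈ box (3 + 1) Lc) (cB : ℝ) (Tc : Fin 4 → Fin 4 → Fin 4 → Fin 4 → ℝ) (μ ν : Fin 4) :
    CauchyRate.lim (fun j => B12Beta.secondMoment (TbalOf Lc (JsBalAn1 (one_le_of_two_le hLc) hr 0 0 0 ((Lc : ℝ) ^ (2 * (3 + 1))) cB Tc) j) μ ν) =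
      CauchyRate.lim (fun j => B12Beta.secondMoment (fun μ' ν' z => (1 / 2) * tadpole (axDressK Lc (KInvStep (d := 3) Lc j))
        (WbalT2Of (Lc := Lc) 0 0 0 ((Lc : ℝ) ^ (2 * (3 + 1))) cB Tc (vh₂S := vh₂SAt (toSite r) Lc) (mixFF := mixFFAt (toSite r) Lc) j μ' 0 ν' z)) μ ν) := by
  congr 1
  funext j
  exact secondMoment_JsBalAn1_colourZero (one_le_of_two_le hLc) hr _ cB Tc j μ ν

end PinnedLimit

end Summit.QuantumFields.BalabanUV.Gaps.D1PinnedColourFreeCore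

end
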